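import Summits.AtomisticToContinuum.HydrodynamicLimit.Theorems.TwoClocksClampedWindowDockTimeZero
import HarnessLib

/-!
# Crux `SpeedCapSurgery.CappedEulerLimit` (stmt-AtomisticToContinuum-17739), line `registered`, stub `stub_cappedKlDivZero`

THE RESTRICTED INITIAL RELATIVE ENTROPY IS AT MOST ONE: for `σ ≤ 1/2`, continuous positive profiles (so
that `λ_N = localGibbsLaw σ a₀ u₀ θ₀ N Φ` is a probability law) and ANY set `S` of initial data,
`KL((Φ_0)_*(λ_N|S) ‖ λ_N) ≤ 1`: `Φ_0 = id` on the good set, which carries `λ_N|S`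
(`lawAt_zero_localGibbsLaw_restrict`), and a measure dominated by a finite measure `ν` has relative entropy at
most `ν(univ)` w.r.t. `ν` (`klDiv_le_measure_univ_of_le`: the density is `≤ 1` a.e. and
`klFun = x log x + 1 - x ≤ 1` on `[0, 1]`); here `λ_N|S ≤ λ_N` and `λ_N(univ) = 1`. No measurability of `S` is
needed. Worker file of the lead prover-line-stmt-AtomisticToContinuum-17739-0
(`--supports stmt-AtomisticToContinuum-17739`).

References: H.-T. Yau, *Relative entropy and hydrodynamics of Ginzburg–Landau models*, Lett. Math. Phys. 22
(1991), §2 (the initial relative entropy of the clock).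
-/

noncomputable section

namespace Summit.AtomisticToContinuum.HydrodynamicLimit.Theorems.CappedEulerLimit

open scoped ENNReal NNReal Topology
open MeasureTheory Filter Set InformationTheory
open Literature.Analysis.FluidPDE
open Literature.MathematicalPhysics.KineticTheory

/-! ### §1 Domination bounds the relative entropy by the total mass of the reference -/

/-- **`KL(μ ‖ ν) ≤ ν(univ)` for a measure `μ` dominated by a finite measure `ν`.** Indeed `μ ≪ ν` with density
`f = dμ/dν ≤ 1` `ν`-a.e. (`Measure.rnDeriv_le_one_of_le`), the divergence is the `ν`-integral of
`klFun f = f log f + 1 - f` (`klDiv_eq_lintegral_klFun_of_ac`), and `klFun ≤ 1` on `[0, 1]` (`x log x ≤ 0`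
there, `Real.mul_log_nonpos`). [folklore] -/
theorem klDiv_le_measure_univ_of_le {α : Type*} [MeasurableSpace α] {μ ν : Measure α} [IsFiniteMeasure ν]
    (hle : μ ≤ ν) : klDiv μ ν ≤ ν univ := by
  haveI : IsFiniteMeasure μ := isFiniteMeasure_of_le ν hle
  rw [klDiv_eq_lintegral_klFun_of_ac (Measure.absolutelyContinuous_of_le hle), ← lintegral_one]
  refine lintegral_mono_ae ?_
  filter_upwards [Measure.rnDeriv_le_one_of_le hle] with x hx
  rw [Pi.one_apply] at hx
  rw [← ENNReal.ofReal_one]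
  refine ENNReal.ofReal_le_ofReal ?_
  have h0 : 0 ≤ (μ.rnDeriv ν x).toReal := ENNReal.toReal_nonneg
  have h1 : (μ.rnDeriv ν x).toReal ≤ 1 := by
    simpa only [ENNReal.toReal_one] using ENNReal.toReal_mono ENNReal.one_ne_top hx
  rw [klFun_apply]
  linarith [Real.mul_log_nonpos h0 h1]

/-! ### §2 At time zero the law started from a restricted local Gibbs law is that restricted law -/

/-- **`lawAt Φ (λ_N|S) 0 = λ_N|S`** for the local Gibbs law `λ_N = localGibbsLaw σ a₀ u₀ θ₀ N Φ` restricted to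
ANY set `S`: `Φ₀ = id` on the good set, which is conull for the Liouville measure, hence for `λ_N ≪ Liouville`
and for `λ_N|S ≤ λ_N`. [folklore] -/
theorem lawAt_zero_localGibbsLaw_restrict (σ : ℝ) (a₀ : T3 → ℝ) (u₀ : T3 → V3) (θ₀ : T3 → ℝ) (N : ℕ)
    (Φ : HardSphereFlow (Torus.geometry (Fin 3)) (hsDiameter σ N) (N + 1))
    (S : Set (Config (N + 1) (Fin 3) T3)) :
    Φ.lawAt ((localGibbsLaw σ a₀ u₀ θ₀ N Φ).restrict S) 0 = (localGibbsLaw σ a₀ u₀ θ₀ N Φ).restrict S := by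
  rw [HardSphereFlow.lawAt_eq]
  have hac : (localGibbsLaw σ a₀ u₀ θ₀ N Φ).restrict S ≪
      liouville (Torus.geometry (Fin 3)) (N + 1) (hsDiameter σ N) := by
    refine (Measure.absolutelyContinuous_of_le Measure.restrict_le_self).trans ?_
    rw [localGibbsLaw, particleLaw_eq]
    exact withDensity_absolutelyContinuous _ _
  have hae : Φ.flow 0 =ᵐ[(localGibbsLaw σ a₀ u₀ θ₀ N Φ).restrict S] id := by
    filter_upwards [hac.ae_le Φ.ae_mem_good] with z hz
    exact Φ.flow_zero z hz
  rw [Measure.map_congr hae, Measure.map_id]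

/-! ### §3 The stub -/

/-- **Stub `stub_cappedKlDivZero` — the restricted initial relative entropy is at most one.** For the
hard-sphere system on `𝕋³` at reduced diameter `σ ≤ 1/2` and continuous positive profiles (so that
`λ_N = localGibbsLaw σ a₀ u₀ θ₀ N Φ` is a probability law, `isProbabilityMeasure_localGibbsLaw`) and ANY set
`S` of initial data: `KL((Φ_0)_*(λ_N|S) ‖ λ_N) ≤ 1`. By `lawAt_zero_localGibbsLaw_restrict` the law at time
`0` is `λ_N|S ≤ λ_N`, and `klDiv_le_measure_univ_of_le` bounds the divergence by `λ_N(univ) = 1` (in closed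
form it equals `1 - λ_N(S')`, `S'` the measurable hull of `S`). [cite: Yau1991, §2] -/
theorem stub_cappedKlDivZero {σ : ℝ} (hσ2 : σ ≤ 1 / 2) {a₀ θ₀ : T3 → ℝ} {u₀ : T3 → V3}
    (ha : Continuous a₀) (hθ : Continuous θ₀) (hu : Continuous u₀) (ha0 : ∀ x, 0 < a₀ x)
    (hθ0 : ∀ x, 0 < θ₀ x) (N : ℕ)
    (Φ : HardSphereFlow (Torus.geometry (Fin 3)) (hsDiameter σ N) (N + 1))
    (S : Set (Config (N + 1) (Fin 3) T3)) :
    klDiv (Φ.lawAt ((localGibbsLaw σ a₀ u₀ θ₀ N Φ).restrict S) 0) (localGibbsLaw σ a₀ u₀ θ₀ N Φ) ≤ 1 := by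
  haveI : IsProbabilityMeasure (localGibbsLaw σ a₀ u₀ θ₀ N Φ) :=
    isProbabilityMeasure_localGibbsLaw ha hθ hu ha0 hθ0 hσ2 N Φ
  rw [lawAt_zero_localGibbsLaw_restrict]
  exact (klDiv_le_measure_univ_of_le Measure.restrict_le_self).trans_eq measure_univ

end Summit.AtomisticToContinuum.HydrodynamicLimit.Theorems.CappedEulerLimit

end
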